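import Summits.ABC.IUTFork.Conditional.AbcOfSGenuineKChosenDepthRadRows1
import HarnessLib

/-!
# R-W table rows DECIDED on the refuted side by the EXACT-RADIUS («RAD») engine at a WILD place — UNCONDITIONALLY:
# part 2: the Reyssat triple `2 + 3¹⁰·109 = 23⁵` at `p = 23` for `l = 17` and `l = 19`

PROOF-ONLY file (no `def`, no new `Prop`, no instance) of the abc-iut cell (WAVE-5 prover seat abc-iut-w5-d236, gen 9; D-0079 R-W
«WINDOW Θ-SIDE INEQUALITY», CLAIM «W:RAD-GENUINEK lane=P−»; sequel of part 1 `AbcOfSGenuineKChosenDepthRadRows1`, same inputs BY NAME: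
this seat's `GenuineK.not_pilotKummerCompatHull_chosen_ratPoint_of_star_envelope_of_not_dvd` (p464754), the fibre-point Tate-exact local
type `GenuineK.absRamificationIdx_kOf_dvd_six_mul_ratPoint` (part 1, over abc-iut-W-ref-2 / abc-iut-W-neg-1's
`ThetaVolumeDatumAt.ramificationIdx_int_dvd_six_mul_ratPoint'`) and the exact pole order `Reyssat.ord_jInv_twentyThree` (`ord_23 j(2/23⁵) = −10`)).
TAKES NO SIDE on [IUTchIII] Cor. 3.12 or on any author.

Per row: at EVERY genuine Θ-volume datum `T` over `(ratPoint (2/23⁵), l)` the hull-level clause S_H (chosen realising ideles, pinned reading —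
the per-datum object of the window binders `hSHw`/`hSHwBad` p447945/p450130/p453137) FAILS for every choice of the free context binders and
Kummer datum; refuting packet `(j = l⋆, any x₀ | 23)`, local type `e ∣ 6·l` by the Tate-exact lemma, one RAD certificate `(A, a₀, N)` per
divisor `e` (desk search HOME/…/w5-d236 work/radcert.py, re-checked by `norm_num`). These are the R-W numerics lead's critical-path rows
«Reyssat @ 17 / 19» (HOME/plan/rescue/R-W/README F2-3; [RAD] margins of abc-iut-W-num-6's SUPPLEMENT v3.4).
NOT claimed: admissibility / Szpiro-badness (margins −1.51 / −1.81, abc-iut-c312-d1's row) / (P6) of `(ratPoint (2/23⁵), l)` and non-emptiness of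
the datum type (apex inputs). HONEST SCOPE as in the parents: SHARP reading; per-label licence STRONGER than print; «refuted as typed» ≠ «refuted in
print»; nothing about the number-level Corollary; typed ≠ proved; instantiated ≠ endorsed.
[cite: Mochizuki2012, IUTchIII Cor. 3.12 Step (xi-f) p. 184; IUTchIV Prop. 1.2 (i)(ii) p. 10, Cor. 2.2 (ii) proof p. 44–46, Thm. 1.10 Steps (ii)–(iii) p. 24–26]
[cite: Serre1972, §1.11–§1.12] [cite: NeukirchANT1999, Ch. II (5.5)] [claim: Mochizuki2012, status: disputed] for every IUT sentence quoted.
-/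

noncomputable section

open Set Function NumberField IsDedekindDomain

namespace Summit.ABC.IUTFork.Conditional

open Thm311 Thm311.Real Cor312 Cor312Vol Cor312Prov Literature.IUT.LogThetaLattice Literature.IUT.LogVolume
  Literature.IUT.HodgeTheaters Literature.IUT.LogVolume.ThetaData Literature.IUT.LogVolume.Cor22
open Literature.NumberTheory.NumberFields Literature.NumberTheory.GaloisRepresentations.Ultrametric
open Literature.NumberTheory.DiophantineGeometry Literature.NumberTheory.DiophantineGeometry.GenEll Summit.ABC.ABC.Theorems

/-- **R-W ROW `pilotDataOfK:frey-2-6436341-6436343:17` (Reyssat, `l = 17`) — REFUTED side, UNCONDITIONALLY, at the WILD place `p = 23`.**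
At every genuine Θ-volume datum `T` over `(ratPoint (2/23⁵), 17)` the hull-level clause S_H (chosen realising ideles, pinned reading) FAILS
for every choice of the free context binders and Kummer datum: at any `x₀ | 23` the local type `e = e(K_{x₀}/ℚ_23)` divides `6·17`
(Tate-exact, `5 ∣ ord_23 j = −10`), and for EACH such `e` the RAD certificate at the top label `j = 8` holds (`h = 10`, `δ = e − 1`;
`(A, a₀, N)` = `(1,0,9)`; `(1,0,10)`; `(1,0,10)`; `(1,0,10)`; `(1,0,10)`; `(2,1,10)`; `(3,1,10)`; `(5,1,10)` for `e = 1, 2, 3, 6, 17, 34, 51, 102`).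
[cite: Mochizuki2012, IUTchIII Cor. 3.12 Step (xi-f) p. 184] [claim: Mochizuki2012, status: disputed] -/
theorem GenuineK.not_pilotKummerCompatHull_chosen_reyssat_seventeen
    (T : Cor22.ThetaVolumeDatumAt (ratPoint (((2 : ℕ) : ℚ) / ((23 ^ 5 : ℕ) : ℚ))) 17) :
    letI := T.instFieldF; letI := T.instNumberFieldF; letI := T.instAlgebraF; letI := T.instFieldK
    letI := T.instNumberFieldK; letI := T.instAlgebraK; letI := T.instFieldFbar; letI := T.instAlgebraFbar
    letI := T.instAlgebraKFbar; letI := T.instIsElliptic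
    ∀ (M : Type) [Field M] [NumberField M]
      (archPk : ∀ (j : (thetaIndex (pilotDataOfK T.D T.K)).Label) (vQ : (thetaIndex (pilotDataOfK T.D T.K)).VQ),
        Set ((logShellsDH (pilotDataOfK T.D T.K) (analyticLogv T.K)).Packet j vQ))
      (archSub : ∀ (j : (thetaIndex (pilotDataOfK T.D T.K)).Label) (v : (thetaIndex (pilotDataOfK T.D T.K)).V),
        Set ((logShellsDH (pilotDataOfK T.D T.K) (analyticLogv T.K)).Packet j ((thetaIndex (pilotDataOfK T.D T.K)).over v)))
      (Ψ : ℤ → ∀ v : (thetaIndex (pilotDataOfK T.D T.K)).V, v ∈ (thetaIndex (pilotDataOfK T.D T.K)).Vbad →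
        Set ((logShellsDH (pilotDataOfK T.D T.K) (analyticLogv T.K)).StarPacket v))
      (act : ℤ → ∀ v : (thetaIndex (pilotDataOfK T.D T.K)).V, v ∈ (thetaIndex (pilotDataOfK T.D T.K)).Vbad →
        (logShellsDH (pilotDataOfK T.D T.K) (analyticLogv T.K)).StarPacket v →
          Module.End ℚ ((logShellsDH (pilotDataOfK T.D T.K) (analyticLogv T.K)).StarPacket v))
      (Mmod : ℤ → ∀ j : (thetaIndex (pilotDataOfK T.D T.K)).LabelStar, Set ((logShellsDH (pilotDataOfK T.D T.K) (analyticLogv T.K)).GlobalPacket j.1))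
      (region : ℤ → ∀ j : (thetaIndex (pilotDataOfK T.D T.K)).LabelStar, FinDivisor M → ∀ vQ : (thetaIndex (pilotDataOfK T.D T.K)).VQ,
        Set ((logShellsDH (pilotDataOfK T.D T.K) (analyticLogv T.K)).Packet j.1 vQ))
      (frobAdm : ℤ → ℤ → ∀ (j : (thetaIndex (pilotDataOfK T.D T.K)).Label) (vQ : (thetaIndex (pilotDataOfK T.D T.K)).VQ),
        Set ((logShellsDH (pilotDataOfK T.D T.K) (analyticLogv T.K)).Packet j vQ) → Prop)
      (frobLogvol : ℤ → ℤ → ∀ (j : (thetaIndex (pilotDataOfK T.D T.K)).Label) (vQ : (thetaIndex (pilotDataOfK T.D T.K)).VQ),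
        Set ((logShellsDH (pilotDataOfK T.D T.K) (analyticLogv T.K)).Packet j vQ) → ℝ)
      (frobΨ : ℤ → ℤ → ∀ v : (thetaIndex (pilotDataOfK T.D T.K)).V, v ∈ (thetaIndex (pilotDataOfK T.D T.K)).Vbad →
        Set ((logShellsDH (pilotDataOfK T.D T.K) (analyticLogv T.K)).StarPacket v))
      (frobMmod : ℤ → ℤ → ∀ j : (thetaIndex (pilotDataOfK T.D T.K)).LabelStar, Set ((logShellsDH (pilotDataOfK T.D T.K) (analyticLogv T.K)).GlobalPacket j.1))
      (unitImage : ℤ → ℤ → ℕ → ∀ (j : (thetaIndex (pilotDataOfK T.D T.K)).Label) (vQ : (thetaIndex (pilotDataOfK T.D T.K)).VQ),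
        Set ((logShellsDH (pilotDataOfK T.D T.K) (analyticLogv T.K)).Packet j vQ))
      (ballImage : ℤ → ℤ → ∀ (j : (thetaIndex (pilotDataOfK T.D T.K)).Label) (vQ : (thetaIndex (pilotDataOfK T.D T.K)).VQ),
        Set ((logShellsDH (pilotDataOfK T.D T.K) (analyticLogv T.K)).Packet j vQ))
      (thetaDiv : ℤ → ℤ → LgpDivisor M (thetaIndex (pilotDataOfK T.D T.K)).lstar)
      (n : ℤ) {HT : Type} {LogLink : HT → HT → Type} {IsFull : ∀ {s t : HT}, LogLink s t → Prop}
      (lat : LGPGaussianLogThetaLattice LogLink IsFull)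
      {Frd : Type} {IsoF : Frd → Frd → Type} {Ob : Frd → Type} {realify : Frd → Frd} {Strip : Type}
      {IsoS : Strip → Strip → Type} {Mv : ∀ v : (thetaIndex (pilotDataOfK T.D T.K)).V, v ∈ (thetaIndex (pilotDataOfK T.D T.K)).Vbad → Type}
      [∀ v h, Monoid (Mv v h)]
      (sig : GlobalLGPFrobenioidSignature (thetaIndex (pilotDataOfK T.D T.K)).lstar (thetaIndex (pilotDataOfK T.D T.K)).V
        (· ∈ (thetaIndex (pilotDataOfK T.D T.K)).Vbad) Frd IsoF Ob realify Strip IsoS Mv)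
      (split : SplittingMonoids Mv) {ObΔ : Type} {N : ∀ v : (thetaIndex (pilotDataOfK T.D T.K)).V, v ∈ (thetaIndex (pilotDataOfK T.D T.K)).Vbad → Type}
      [∀ v h, Monoid (N v h)] (qData : QPilotData ObΔ N)
      (qK : ∀ v : (thetaIndex (pilotDataOfK T.D T.K)).V, v ∈ (thetaIndex (pilotDataOfK T.D T.K)).Vbad →
        Set ((logShellsDH (pilotDataOfK T.D T.K) (analyticLogv T.K)).StarPacket v)),
      ¬ Cor312Vol.PilotKummerCompatHull
          (LatticeSituation.ofShells (logShellsDH (pilotDataOfK T.D T.K) (analyticLogv T.K)) M archPk archSub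
            (summandPiecesPr (pilotDataOfK T.D T.K) (logvAnalytic_analyticLogv (F := T.K))).Adm
            (summandPiecesPr (pilotDataOfK T.D T.K) (logvAnalytic_analyticLogv (F := T.K))).logvol Ψ act Mmod region frobAdm frobLogvol frobΨ
            frobMmod unitImage ballImage thetaDiv)
          (settingPrVolSharp (pilotDataOfK T.D T.K) (logvAnalytic_analyticLogv (F := T.K)) M archPk archSub Ψ act Mmod region n lat sig split qData
            (exists_realising_qIdeles_pilotDataOfK T.D).choose (exists_realising_thetaIdeles_pilotDataOfK T.D).choose
            (exists_realising_qIdeles_pilotDataOfK T.D).choose_spec.1 (exists_realising_qIdeles_pilotDataOfK T.D).choose_spec.2.1)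
          (fun _ => Cor312.Setting.qRegion
            (settingPrVolSharp (pilotDataOfK T.D T.K) (logvAnalytic_analyticLogv (F := T.K)) M archPk archSub Ψ act Mmod region n lat sig split qData
              (exists_realising_qIdeles_pilotDataOfK T.D).choose (exists_realising_thetaIdeles_pilotDataOfK T.D).choose
              (exists_realising_qIdeles_pilotDataOfK T.D).choose_spec.1 (exists_realising_qIdeles_pilotDataOfK T.D).choose_spec.2.1)) qK := by
  classical
  letI := T.instFieldF; letI := T.instNumberFieldF; letI := T.instAlgebraF; letI := T.instFieldK
  letI := T.instNumberFieldK; letI := T.instAlgebraK; letI := T.instFieldFbar; letI := T.instAlgebraFbar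
  letI := T.instAlgebraKFbar; letI := T.instIsElliptic
  have hp : Nat.Prime 23 := by norm_num
  haveI : Fact (Nat.Prime 23) := ⟨hp⟩
  intro M _ _ archPk archSub Ψ act Mmod region frobAdm frobLogvol frobΨ frobMmod unitImage ballImage thetaDiv n HT LogLink IsFull lat
    Frd IsoF Ob realify Strip IsoS Mv _ sig split ObΔ N _ qData qK
  obtain ⟨v, hv⟩ := (thetaIndex (pilotDataOfK T.D T.K)).fibre_nonempty (.inr ⟨23, hp⟩)
  have hord : ∀ u : HeightOneSpectrum (𝓞 ℚ), Rat.HeightOneSpectrum.natGenerator u = ((⟨23, hp⟩ : Nat.Primes) : ℕ) →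
      Literature.IUT.LogVolume.ord ℚ u (Cor22.jInv (((2 : ℕ) : ℚ) / ((23 ^ 5 : ℕ) : ℚ))) = -((10 : ℕ) : ℤ) :=
    fun u hu => Reyssat.ord_jInv_twentyThree u hu
  have hpole : ∀ u : HeightOneSpectrum (𝓞 ℚ), Rat.HeightOneSpectrum.natGenerator u = ((⟨23, hp⟩ : Nat.Primes) : ℕ) →
      Literature.IUT.LogVolume.ord ℚ u (Cor22.jInv (((2 : ℕ) : ℚ) / ((23 ^ 5 : ℕ) : ℚ))) < 0 :=
    fun u hu => by rw [hord u hu]; norm_num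
  have hordk : ∀ u : HeightOneSpectrum (𝓞 ℚ), Rat.HeightOneSpectrum.natGenerator u = ((⟨23, hp⟩ : Nat.Primes) : ℕ) →
      (5 : ℤ) ∣ Literature.IUT.LogVolume.ord ℚ u (Cor22.jInv (((2 : ℕ) : ℚ) / ((23 ^ 5 : ℕ) : ℚ))) :=
    fun u hu => by rw [hord u hu]; norm_num
  have hdvd := GenuineK.absRamificationIdx_kOf_dvd_six_mul_ratPoint T ⟨23, hp⟩ (by norm_num) (by norm_num) (by norm_num) (by norm_num)
    hpole hordk ⟨v, hv⟩
  -- the local types `e ∣ 102`, each with its certificate `(A, a₀, N)`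
  have key : ∀ e : ℕ, absRamificationIdx 23 (kOf (pilotDataOfK T.D T.K) 23 ⟨v, hv⟩) = e → e ∣ 6 * 17 →
      ¬ Cor312Vol.PilotKummerCompatHull
          (LatticeSituation.ofShells (logShellsDH (pilotDataOfK T.D T.K) (analyticLogv T.K)) M archPk archSub
            (summandPiecesPr (pilotDataOfK T.D T.K) (logvAnalytic_analyticLogv (F := T.K))).Adm
            (summandPiecesPr (pilotDataOfK T.D T.K) (logvAnalytic_analyticLogv (F := T.K))).logvol Ψ act Mmod region frobAdm frobLogvol frobΨ
            frobMmod unitImage ballImage thetaDiv)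
          (settingPrVolSharp (pilotDataOfK T.D T.K) (logvAnalytic_analyticLogv (F := T.K)) M archPk archSub Ψ act Mmod region n lat sig split qData
            (exists_realising_qIdeles_pilotDataOfK T.D).choose (exists_realising_thetaIdeles_pilotDataOfK T.D).choose
            (exists_realising_qIdeles_pilotDataOfK T.D).choose_spec.1 (exists_realising_qIdeles_pilotDataOfK T.D).choose_spec.2.1)
          (fun _ => Cor312.Setting.qRegion
            (settingPrVolSharp (pilotDataOfK T.D T.K) (logvAnalytic_analyticLogv (F := T.K)) M archPk archSub Ψ act Mmod region n lat sig split qData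
              (exists_realising_qIdeles_pilotDataOfK T.D).choose (exists_realising_thetaIdeles_pilotDataOfK T.D).choose
              (exists_realising_qIdeles_pilotDataOfK T.D).choose_spec.1 (exists_realising_qIdeles_pilotDataOfK T.D).choose_spec.2.1)) qK := by
    intro e hex he
    have hmem : e ∈ Nat.divisors 102 := Nat.mem_divisors.2 ⟨he, by norm_num⟩
    have hdivs : Nat.divisors 102 = {1, 2, 3, 6, 17, 34, 51, 102} := by decide
    rw [hdivs] at hmem
    simp only [Finset.mem_insert, Finset.mem_singleton] at hmem
    rcases hmem with rfl | rfl | rfl | rfl | rfl | rfl | rfl | rfl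
    · exact GenuineK.not_pilotKummerCompatHull_chosen_ratPoint_of_star_envelope_of_not_dvd T ⟨23, hp⟩ (by norm_num) (by norm_num)
        10 (by norm_num) hord 7 (by norm_num) 1 1 0 9 (by norm_num) (by norm_num) (by norm_num) (by norm_num) (Or.inl rfl)
        (by norm_num) (by norm_num) (by norm_num) ⟨v, hv⟩ hex M archPk archSub Ψ act Mmod region frobAdm frobLogvol frobΨ frobMmod
        unitImage ballImage thetaDiv n lat sig split qData qK
    · exact GenuineK.not_pilotKummerCompatHull_chosen_ratPoint_of_star_envelope_of_not_dvd T ⟨23, hp⟩ (by norm_num) (by norm_num)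
        10 (by norm_num) hord 7 (by norm_num) 2 1 0 10 (by norm_num) (by norm_num) (by norm_num) (by norm_num) (Or.inl rfl)
        (by norm_num) (by norm_num) (by norm_num) ⟨v, hv⟩ hex M archPk archSub Ψ act Mmod region frobAdm frobLogvol frobΨ frobMmod
        unitImage ballImage thetaDiv n lat sig split qData qK
    · exact GenuineK.not_pilotKummerCompatHull_chosen_ratPoint_of_star_envelope_of_not_dvd T ⟨23, hp⟩ (by norm_num) (by norm_num)
        10 (by norm_num) hord 7 (by norm_num) 3 1 0 10 (by norm_num) (by norm_num) (by norm_num) (by norm_num) (Or.inl rfl)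
        (by norm_num) (by norm_num) (by norm_num) ⟨v, hv⟩ hex M archPk archSub Ψ act Mmod region frobAdm frobLogvol frobΨ frobMmod
        unitImage ballImage thetaDiv n lat sig split qData qK
    · exact GenuineK.not_pilotKummerCompatHull_chosen_ratPoint_of_star_envelope_of_not_dvd T ⟨23, hp⟩ (by norm_num) (by norm_num)
        10 (by norm_num) hord 7 (by norm_num) 6 1 0 10 (by norm_num) (by norm_num) (by norm_num) (by norm_num) (Or.inl rfl)
        (by norm_num) (by norm_num) (by norm_num) ⟨v, hv⟩ hex M archPk archSub Ψ act Mmod region frobAdm frobLogvol frobΨ frobMmod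
        unitImage ballImage thetaDiv n lat sig split qData qK
    · exact GenuineK.not_pilotKummerCompatHull_chosen_ratPoint_of_star_envelope_of_not_dvd T ⟨23, hp⟩ (by norm_num) (by norm_num)
        10 (by norm_num) hord 7 (by norm_num) 17 1 0 10 (by norm_num) (by norm_num) (by norm_num) (by norm_num) (Or.inl rfl)
        (by norm_num) (by norm_num) (by norm_num) ⟨v, hv⟩ hex M archPk archSub Ψ act Mmod region frobAdm frobLogvol frobΨ frobMmod
        unitImage ballImage thetaDiv n lat sig split qData qK
    · exact GenuineK.not_pilotKummerCompatHull_chosen_ratPoint_of_star_envelope_of_not_dvd T ⟨23, hp⟩ (by norm_num) (by norm_num)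
        10 (by norm_num) hord 7 (by norm_num) 34 2 1 10 (by norm_num) (by norm_num) (by norm_num) (by norm_num) (Or.inr (by norm_num))
        (by norm_num) (by norm_num) (by norm_num) ⟨v, hv⟩ hex M archPk archSub Ψ act Mmod region frobAdm frobLogvol frobΨ frobMmod
        unitImage ballImage thetaDiv n lat sig split qData qK
    · exact GenuineK.not_pilotKummerCompatHull_chosen_ratPoint_of_star_envelope_of_not_dvd T ⟨23, hp⟩ (by norm_num) (by norm_num)
        10 (by norm_num) hord 7 (by norm_num) 51 3 1 10 (by norm_num) (by norm_num) (by norm_num) (by norm_num) (Or.inr (by norm_num))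
        (by norm_num) (by norm_num) (by norm_num) ⟨v, hv⟩ hex M archPk archSub Ψ act Mmod region frobAdm frobLogvol frobΨ frobMmod
        unitImage ballImage thetaDiv n lat sig split qData qK
    · exact GenuineK.not_pilotKummerCompatHull_chosen_ratPoint_of_star_envelope_of_not_dvd T ⟨23, hp⟩ (by norm_num) (by norm_num)
        10 (by norm_num) hord 7 (by norm_num) 102 5 1 10 (by norm_num) (by norm_num) (by norm_num) (by norm_num) (Or.inr (by norm_num))
        (by norm_num) (by norm_num) (by norm_num) ⟨v, hv⟩ hex M archPk archSub Ψ act Mmod region frobAdm frobLogvol frobΨ frobMmod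
        unitImage ballImage thetaDiv n lat sig split qData qK
  exact key _ rfl hdvd

/-- **R-W ROW `pilotDataOfK:frey-2-6436341-6436343:19` (Reyssat, `l = 19`) — REFUTED side, UNCONDITIONALLY, at the WILD place `p = 23`.**
At every genuine Θ-volume datum `T` over `(ratPoint (2/23⁵), 19)` the hull-level clause S_H (chosen realising ideles, pinned reading) FAILS
for every choice of the free context binders and Kummer datum: at any `x₀ | 23` the local type `e = e(K_{x₀}/ℚ_23)` divides `6·19`
(Tate-exact, `5 ∣ ord_23 j = −10`), and for EACH such `e` the RAD certificate at the top label `j = 9` holds (`h = 10`, `δ = e − 1`;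
`(A, a₀, N)` = `(1,0,11)`; `(1,0,11)`; `(1,0,11)`; `(1,0,12)`; `(1,0,12)`; `(2,1,12)`; `(3,1,11)`; `(6,1,11)` for `e = 1, 2, 3, 6, 19, 38, 57, 114`).
[cite: Mochizuki2012, IUTchIII Cor. 3.12 Step (xi-f) p. 184] [claim: Mochizuki2012, status: disputed] -/
theorem GenuineK.not_pilotKummerCompatHull_chosen_reyssat_nineteen
    (T : Cor22.ThetaVolumeDatumAt (ratPoint (((2 : ℕ) : ℚ) / ((23 ^ 5 : ℕ) : ℚ))) 19) :
    letI := T.instFieldF; letI := T.instNumberFieldF; letI := T.instAlgebraF; letI := T.instFieldK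
    letI := T.instNumberFieldK; letI := T.instAlgebraK; letI := T.instFieldFbar; letI := T.instAlgebraFbar
    letI := T.instAlgebraKFbar; letI := T.instIsElliptic
    ∀ (M : Type) [Field M] [NumberField M]
      (archPk : ∀ (j : (thetaIndex (pilotDataOfK T.D T.K)).Label) (vQ : (thetaIndex (pilotDataOfK T.D T.K)).VQ),
        Set ((logShellsDH (pilotDataOfK T.D T.K) (analyticLogv T.K)).Packet j vQ))
      (archSub : ∀ (j : (thetaIndex (pilotDataOfK T.D T.K)).Label) (v : (thetaIndex (pilotDataOfK T.D T.K)).V),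
        Set ((logShellsDH (pilotDataOfK T.D T.K) (analyticLogv T.K)).Packet j ((thetaIndex (pilotDataOfK T.D T.K)).over v)))
      (Ψ : ℤ → ∀ v : (thetaIndex (pilotDataOfK T.D T.K)).V, v ∈ (thetaIndex (pilotDataOfK T.D T.K)).Vbad →
        Set ((logShellsDH (pilotDataOfK T.D T.K) (analyticLogv T.K)).StarPacket v))
      (act : ℤ → ∀ v : (thetaIndex (pilotDataOfK T.D T.K)).V, v ∈ (thetaIndex (pilotDataOfK T.D T.K)).Vbad →
        (logShellsDH (pilotDataOfK T.D T.K) (analyticLogv T.K)).StarPacket v →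
          Module.End ℚ ((logShellsDH (pilotDataOfK T.D T.K) (analyticLogv T.K)).StarPacket v))
      (Mmod : ℤ → ∀ j : (thetaIndex (pilotDataOfK T.D T.K)).LabelStar, Set ((logShellsDH (pilotDataOfK T.D T.K) (analyticLogv T.K)).GlobalPacket j.1))
      (region : ℤ → ∀ j : (thetaIndex (pilotDataOfK T.D T.K)).LabelStar, FinDivisor M → ∀ vQ : (thetaIndex (pilotDataOfK T.D T.K)).VQ,
        Set ((logShellsDH (pilotDataOfK T.D T.K) (analyticLogv T.K)).Packet j.1 vQ))
      (frobAdm : ℤ → ℤ → ∀ (j : (thetaIndex (pilotDataOfK T.D T.K)).Label) (vQ : (thetaIndex (pilotDataOfK T.D T.K)).VQ),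
        Set ((logShellsDH (pilotDataOfK T.D T.K) (analyticLogv T.K)).Packet j vQ) → Prop)
      (frobLogvol : ℤ → ℤ → ∀ (j : (thetaIndex (pilotDataOfK T.D T.K)).Label) (vQ : (thetaIndex (pilotDataOfK T.D T.K)).VQ),
        Set ((logShellsDH (pilotDataOfK T.D T.K) (analyticLogv T.K)).Packet j vQ) → ℝ)
      (frobΨ : ℤ → ℤ → ∀ v : (thetaIndex (pilotDataOfK T.D T.K)).V, v ∈ (thetaIndex (pilotDataOfK T.D T.K)).Vbad →
        Set ((logShellsDH (pilotDataOfK T.D T.K) (analyticLogv T.K)).StarPacket v))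
      (frobMmod : ℤ → ℤ → ∀ j : (thetaIndex (pilotDataOfK T.D T.K)).LabelStar, Set ((logShellsDH (pilotDataOfK T.D T.K) (analyticLogv T.K)).GlobalPacket j.1))
      (unitImage : ℤ → ℤ → ℕ → ∀ (j : (thetaIndex (pilotDataOfK T.D T.K)).Label) (vQ : (thetaIndex (pilotDataOfK T.D T.K)).VQ),
        Set ((logShellsDH (pilotDataOfK T.D T.K) (analyticLogv T.K)).Packet j vQ))
      (ballImage : ℤ → ℤ → ∀ (j : (thetaIndex (pilotDataOfK T.D T.K)).Label) (vQ : (thetaIndex (pilotDataOfK T.D T.K)).VQ),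
        Set ((logShellsDH (pilotDataOfK T.D T.K) (analyticLogv T.K)).Packet j vQ))
      (thetaDiv : ℤ → ℤ → LgpDivisor M (thetaIndex (pilotDataOfK T.D T.K)).lstar)
      (n : ℤ) {HT : Type} {LogLink : HT → HT → Type} {IsFull : ∀ {s t : HT}, LogLink s t → Prop}
      (lat : LGPGaussianLogThetaLattice LogLink IsFull)
      {Frd : Type} {IsoF : Frd → Frd → Type} {Ob : Frd → Type} {realify : Frd → Frd} {Strip : Type}
      {IsoS : Strip → Strip → Type} {Mv : ∀ v : (thetaIndex (pilotDataOfK T.D T.K)).V, v ∈ (thetaIndex (pilotDataOfK T.D T.K)).Vbad → Type}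
      [∀ v h, Monoid (Mv v h)]
      (sig : GlobalLGPFrobenioidSignature (thetaIndex (pilotDataOfK T.D T.K)).lstar (thetaIndex (pilotDataOfK T.D T.K)).V
        (· ∈ (thetaIndex (pilotDataOfK T.D T.K)).Vbad) Frd IsoF Ob realify Strip IsoS Mv)
      (split : SplittingMonoids Mv) {ObΔ : Type} {N : ∀ v : (thetaIndex (pilotDataOfK T.D T.K)).V, v ∈ (thetaIndex (pilotDataOfK T.D T.K)).Vbad → Type}
      [∀ v h, Monoid (N v h)] (qData : QPilotData ObΔ N)
      (qK : ∀ v : (thetaIndex (pilotDataOfK T.D T.K)).V, v ∈ (thetaIndex (pilotDataOfK T.D T.K)).Vbad →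
        Set ((logShellsDH (pilotDataOfK T.D T.K) (analyticLogv T.K)).StarPacket v)),
      ¬ Cor312Vol.PilotKummerCompatHull
          (LatticeSituation.ofShells (logShellsDH (pilotDataOfK T.D T.K) (analyticLogv T.K)) M archPk archSub
            (summandPiecesPr (pilotDataOfK T.D T.K) (logvAnalytic_analyticLogv (F := T.K))).Adm
            (summandPiecesPr (pilotDataOfK T.D T.K) (logvAnalytic_analyticLogv (F := T.K))).logvol Ψ act Mmod region frobAdm frobLogvol frobΨ
            frobMmod unitImage ballImage thetaDiv)
          (settingPrVolSharp (pilotDataOfK T.D T.K) (logvAnalytic_analyticLogv (F := T.K)) M archPk archSub Ψ act Mmod region n lat sig split qData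
            (exists_realising_qIdeles_pilotDataOfK T.D).choose (exists_realising_thetaIdeles_pilotDataOfK T.D).choose
            (exists_realising_qIdeles_pilotDataOfK T.D).choose_spec.1 (exists_realising_qIdeles_pilotDataOfK T.D).choose_spec.2.1)
          (fun _ => Cor312.Setting.qRegion
            (settingPrVolSharp (pilotDataOfK T.D T.K) (logvAnalytic_analyticLogv (F := T.K)) M archPk archSub Ψ act Mmod region n lat sig split qData
              (exists_realising_qIdeles_pilotDataOfK T.D).choose (exists_realising_thetaIdeles_pilotDataOfK T.D).choose
              (exists_realising_qIdeles_pilotDataOfK T.D).choose_spec.1 (exists_realising_qIdeles_pilotDataOfK T.D).choose_spec.2.1)) qK := by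
  classical
  letI := T.instFieldF; letI := T.instNumberFieldF; letI := T.instAlgebraF; letI := T.instFieldK
  letI := T.instNumberFieldK; letI := T.instAlgebraK; letI := T.instFieldFbar; letI := T.instAlgebraFbar
  letI := T.instAlgebraKFbar; letI := T.instIsElliptic
  have hp : Nat.Prime 23 := by norm_num
  haveI : Fact (Nat.Prime 23) := ⟨hp⟩
  intro M _ _ archPk archSub Ψ act Mmod region frobAdm frobLogvol frobΨ frobMmod unitImage ballImage thetaDiv n HT LogLink IsFull lat
    Frd IsoF Ob realify Strip IsoS Mv _ sig split ObΔ N _ qData qK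
  obtain ⟨v, hv⟩ := (thetaIndex (pilotDataOfK T.D T.K)).fibre_nonempty (.inr ⟨23, hp⟩)
  have hord : ∀ u : HeightOneSpectrum (𝓞 ℚ), Rat.HeightOneSpectrum.natGenerator u = ((⟨23, hp⟩ : Nat.Primes) : ℕ) →
      Literature.IUT.LogVolume.ord ℚ u (Cor22.jInv (((2 : ℕ) : ℚ) / ((23 ^ 5 : ℕ) : ℚ))) = -((10 : ℕ) : ℤ) :=
    fun u hu => Reyssat.ord_jInv_twentyThree u hu
  have hpole : ∀ u : HeightOneSpectrum (𝓞 ℚ), Rat.HeightOneSpectrum.natGenerator u = ((⟨23, hp⟩ : Nat.Primes) : ℕ) →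
      Literature.IUT.LogVolume.ord ℚ u (Cor22.jInv (((2 : ℕ) : ℚ) / ((23 ^ 5 : ℕ) : ℚ))) < 0 :=
    fun u hu => by rw [hord u hu]; norm_num
  have hordk : ∀ u : HeightOneSpectrum (𝓞 ℚ), Rat.HeightOneSpectrum.natGenerator u = ((⟨23, hp⟩ : Nat.Primes) : ℕ) →
      (5 : ℤ) ∣ Literature.IUT.LogVolume.ord ℚ u (Cor22.jInv (((2 : ℕ) : ℚ) / ((23 ^ 5 : ℕ) : ℚ))) :=
    fun u hu => by rw [hord u hu]; norm_num
  have hdvd := GenuineK.absRamificationIdx_kOf_dvd_six_mul_ratPoint T ⟨23, hp⟩ (by norm_num) (by norm_num) (by norm_num) (by norm_num)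
    hpole hordk ⟨v, hv⟩
  -- the local types `e ∣ 114`, each with its certificate `(A, a₀, N)`
  have key : ∀ e : ℕ, absRamificationIdx 23 (kOf (pilotDataOfK T.D T.K) 23 ⟨v, hv⟩) = e → e ∣ 6 * 19 →
      ¬ Cor312Vol.PilotKummerCompatHull
          (LatticeSituation.ofShells (logShellsDH (pilotDataOfK T.D T.K) (analyticLogv T.K)) M archPk archSub
            (summandPiecesPr (pilotDataOfK T.D T.K) (logvAnalytic_analyticLogv (F := T.K))).Adm
            (summandPiecesPr (pilotDataOfK T.D T.K) (logvAnalytic_analyticLogv (F := T.K))).logvol Ψ act Mmod region frobAdm frobLogvol frobΨ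
            frobMmod unitImage ballImage thetaDiv)
          (settingPrVolSharp (pilotDataOfK T.D T.K) (logvAnalytic_analyticLogv (F := T.K)) M archPk archSub Ψ act Mmod region n lat sig split qData
            (exists_realising_qIdeles_pilotDataOfK T.D).choose (exists_realising_thetaIdeles_pilotDataOfK T.D).choose
            (exists_realising_qIdeles_pilotDataOfK T.D).choose_spec.1 (exists_realising_qIdeles_pilotDataOfK T.D).choose_spec.2.1)
          (fun _ => Cor312.Setting.qRegion
            (settingPrVolSharp (pilotDataOfK T.D T.K) (logvAnalytic_analyticLogv (F := T.K)) M archPk archSub Ψ act Mmod region n lat sig split qData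
              (exists_realising_qIdeles_pilotDataOfK T.D).choose (exists_realising_thetaIdeles_pilotDataOfK T.D).choose
              (exists_realising_qIdeles_pilotDataOfK T.D).choose_spec.1 (exists_realising_qIdeles_pilotDataOfK T.D).choose_spec.2.1)) qK := by
    intro e hex he
    have hmem : e ∈ Nat.divisors 114 := Nat.mem_divisors.2 ⟨he, by norm_num⟩
    have hdivs : Nat.divisors 114 = {1, 2, 3, 6, 19, 38, 57, 114} := by decide
    rw [hdivs] at hmem
    simp only [Finset.mem_insert, Finset.mem_singleton] at hmem
    rcases hmem with rfl | rfl | rfl | rfl | rfl | rfl | rfl | rfl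
    · exact GenuineK.not_pilotKummerCompatHull_chosen_ratPoint_of_star_envelope_of_not_dvd T ⟨23, hp⟩ (by norm_num) (by norm_num)
        10 (by norm_num) hord 8 (by norm_num) 1 1 0 11 (by norm_num) (by norm_num) (by norm_num) (by norm_num) (Or.inl rfl)
        (by norm_num) (by norm_num) (by norm_num) ⟨v, hv⟩ hex M archPk archSub Ψ act Mmod region frobAdm frobLogvol frobΨ frobMmod
        unitImage ballImage thetaDiv n lat sig split qData qK
    · exact GenuineK.not_pilotKummerCompatHull_chosen_ratPoint_of_star_envelope_of_not_dvd T ⟨23, hp⟩ (by norm_num) (by norm_num)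
        10 (by norm_num) hord 8 (by norm_num) 2 1 0 11 (by norm_num) (by norm_num) (by norm_num) (by norm_num) (Or.inl rfl)
        (by norm_num) (by norm_num) (by norm_num) ⟨v, hv⟩ hex M archPk archSub Ψ act Mmod region frobAdm frobLogvol frobΨ frobMmod
        unitImage ballImage thetaDiv n lat sig split qData qK
    · exact GenuineK.not_pilotKummerCompatHull_chosen_ratPoint_of_star_envelope_of_not_dvd T ⟨23, hp⟩ (by norm_num) (by norm_num)
        10 (by norm_num) hord 8 (by norm_num) 3 1 0 11 (by norm_num) (by norm_num) (by norm_num) (by norm_num) (Or.inl rfl)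
        (by norm_num) (by norm_num) (by norm_num) ⟨v, hv⟩ hex M archPk archSub Ψ act Mmod region frobAdm frobLogvol frobΨ frobMmod
        unitImage ballImage thetaDiv n lat sig split qData qK
    · exact GenuineK.not_pilotKummerCompatHull_chosen_ratPoint_of_star_envelope_of_not_dvd T ⟨23, hp⟩ (by norm_num) (by norm_num)
        10 (by norm_num) hord 8 (by norm_num) 6 1 0 12 (by norm_num) (by norm_num) (by norm_num) (by norm_num) (Or.inl rfl)
        (by norm_num) (by norm_num) (by norm_num) ⟨v, hv⟩ hex M archPk archSub Ψ act Mmod region frobAdm frobLogvol frobΨ frobMmod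
        unitImage ballImage thetaDiv n lat sig split qData qK
    · exact GenuineK.not_pilotKummerCompatHull_chosen_ratPoint_of_star_envelope_of_not_dvd T ⟨23, hp⟩ (by norm_num) (by norm_num)
        10 (by norm_num) hord 8 (by norm_num) 19 1 0 12 (by norm_num) (by norm_num) (by norm_num) (by norm_num) (Or.inl rfl)
        (by norm_num) (by norm_num) (by norm_num) ⟨v, hv⟩ hex M archPk archSub Ψ act Mmod region frobAdm frobLogvol frobΨ frobMmod
        unitImage ballImage thetaDiv n lat sig split qData qK
    · exact GenuineK.not_pilotKummerCompatHull_chosen_ratPoint_of_star_envelope_of_not_dvd T ⟨23, hp⟩ (by norm_num) (by norm_num)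
        10 (by norm_num) hord 8 (by norm_num) 38 2 1 12 (by norm_num) (by norm_num) (by norm_num) (by norm_num) (Or.inr (by norm_num))
        (by norm_num) (by norm_num) (by norm_num) ⟨v, hv⟩ hex M archPk archSub Ψ act Mmod region frobAdm frobLogvol frobΨ frobMmod
        unitImage ballImage thetaDiv n lat sig split qData qK
    · exact GenuineK.not_pilotKummerCompatHull_chosen_ratPoint_of_star_envelope_of_not_dvd T ⟨23, hp⟩ (by norm_num) (by norm_num)
        10 (by norm_num) hord 8 (by norm_num) 57 3 1 11 (by norm_num) (by norm_num) (by norm_num) (by norm_num) (Or.inr (by norm_num))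
        (by norm_num) (by norm_num) (by norm_num) ⟨v, hv⟩ hex M archPk archSub Ψ act Mmod region frobAdm frobLogvol frobΨ frobMmod
        unitImage ballImage thetaDiv n lat sig split qData qK
    · exact GenuineK.not_pilotKummerCompatHull_chosen_ratPoint_of_star_envelope_of_not_dvd T ⟨23, hp⟩ (by norm_num) (by norm_num)
        10 (by norm_num) hord 8 (by norm_num) 114 6 1 11 (by norm_num) (by norm_num) (by norm_num) (by norm_num) (Or.inr (by norm_num))
        (by norm_num) (by norm_num) (by norm_num) ⟨v, hv⟩ hex M archPk archSub Ψ act Mmod region frobAdm frobLogvol frobΨ frobMmod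
        unitImage ballImage thetaDiv n lat sig split qData qK
  exact key _ rfl hdvd


end Summit.ABC.IUTFork.Conditional

end
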